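import Literature.Computability.Cryptography.RegevSamplerSizes
import Literature.Computability.Complexity.CodeFPOfUnary
import Literature.Computability.Complexity.CountingHierarchyProofs
import HarnessLib

/-!
# Regev 2009, Lemma 3.14 in machine form: polynomial exponents for the parameters `q`, `α`, `θ`

Topic `Literature/Computability/Cryptography`, grouping namespace `Regev2009.SamplerRegs`; sequel of
`RegevSamplerSizes.lean`. The step-family fact quantifies over POLYNOMIAL-TIME parameter functions
`q : ℕ → ℕ` and `a : ℕ → ℚ` (`α(n) = a(n)`); the register schedule of the sampler needs an exponent `b(n)` with
`α(n)q(n) ≤ 2^{b(n)}` and `θ(n) ≤ 2^{b(n)+1}` that is itself a polynomial (so that the layout is computable from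
the input length). This file extracts it: a polynomial-time function has polynomially bounded output length
(`exists_poly_length_le_of_mem_FP`), a natural number is `< 2^{|binary code|}` and a rational is within
`[2^{-|code|}, 2^{|code|}]` in absolute value (`RegevSamplerSizes`).

* `exists_poly_lt_two_pow` — `q(n) < 2^{s(n)}` for a polynomial `s`;
* `exists_poly_length_encodeRat_le`, `exists_poly_abs_window` — `|a(n)| ≤ 2^{s(n)}` and `2^{-s(n)} ≤ |a(n)|`
  (`a(n) ≠ 0`);
* `exists_poly_param_window` — ONE polynomial `b` with `a(n)q(n) ≤ 2^{b(n)}`, `2^{-b(n)} ≤ a(n)` (for `a(n) > 0`)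
  and `θ(n) ≤ 2^{b(n)+1}` (for `0 ≤ a(n) ≤ 1`, `n ≥ 1`).

Everything here is proved; no named fact is introduced.

## References

* O. Regev, *On lattices, learning with errors, random linear codes, and cryptography*, J. ACM 56 (2009),
  art. 34, Lemma 3.14 (proof), Theorem 3.1 (proof: the parameters are polynomial-time computable) [Regev2009].
* S. Arora, B. Barak, *Computational Complexity: A Modern Approach*, CUP 2009, §1.3 [AroraBarak2009].
-/

noncomputable section

namespace Literature.Computability.Cryptography

namespace Regev2009

namespace SamplerRegs

open Literature.Algebra.EuclideanLattices Literature.Algebra.EuclideanLattices.Regev2009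
  Literature.Computability.Complexity _root_.Computability Polynomial

/-! ### Natural parameters -/

/-- **A polynomial-time natural parameter is `2^{poly}`-bounded**: `q(n) < 2^{s(n)}`.
[cite: AroraBarak2009, §1.3] -/
theorem exists_poly_lt_two_pow {q : ℕ → ℕ} (h : PolyTimeComputable unaryEncodeNat encodeNat q) :
    ∃ s : Polynomial ℕ, ∀ n, q n < 2 ^ s.eval n := by
  obtain ⟨f, hf, hfq⟩ := CodeFP.codeFP_natParam h
  obtain ⟨s, hs⟩ := exists_poly_length_le_of_mem_FP hf
  refine ⟨s, fun n => ?_⟩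
  have h1 : q n < 2 ^ (encodeNat (q n)).length := by
    rw [TM2Pass.length_encodeNat_eq_size]; exact Nat.lt_size_self _
  refine lt_of_lt_of_le h1 (Nat.pow_le_pow_right (by norm_num) ?_)
  have h2 := hs (CodeFP.unE n)
  rw [hfq n, CodeFP.length_unE] at h2
  exact h2

/-! ### Rational parameters -/

/-- **A polynomial-time rational parameter has polynomially long codes**: `|code (a n)| ≤ s(n)`.
[cite: AroraBarak2009, §1.3] -/
theorem exists_poly_length_encodeRat_le {a : ℕ → ℚ} (h : PolyTimeComputable unaryEncodeNat encodeRat a) :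
    ∃ s : Polynomial ℕ, ∀ n, (encodeRat (a n)).length ≤ s.eval n := by
  obtain ⟨f, hf, hfa⟩ := (CodeFP.ofPolyTimeComputable_unE h : CodeFP CodeFP.unE encodeRat a)
  obtain ⟨s, hs⟩ := exists_poly_length_le_of_mem_FP hf
  refine ⟨s, fun n => ?_⟩
  have h2 := hs (CodeFP.unE n)
  rw [hfa n, CodeFP.length_unE] at h2
  exact h2

/-- **A polynomial-time rational parameter lives in `[2^{-s(n)}, 2^{s(n)}]` in absolute value** (the lower bound
for `a(n) ≠ 0`). [folklore] -/
theorem exists_poly_abs_window {a : ℕ → ℚ} (h : PolyTimeComputable unaryEncodeNat encodeRat a) :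
    ∃ s : Polynomial ℕ, ∀ n, |(a n : ℝ)| ≤ (2 : ℝ) ^ s.eval n ∧ (a n ≠ 0 → (2⁻¹ : ℝ) ^ s.eval n ≤ |(a n : ℝ)|) := by
  obtain ⟨s, hs⟩ := exists_poly_length_encodeRat_le h
  refine ⟨s, fun n => ⟨(abs_cast_le_two_pow (a n)).trans (pow_le_pow_right₀ one_le_two (hs n)), fun h0 => ?_⟩⟩
  exact le_trans (pow_le_pow_of_le_one (by norm_num) (by norm_num) (hs n)) (two_pow_inv_le_abs_cast h0)

/-! ### One exponent for `αq` and `θ` -/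

/-- **The parameter exponent.** For polynomial-time `a`, `q` there is ONE polynomial `b` with, for every `n`:
`a(n)q(n) ≤ 2^{b(n)}`; `2^{-b(n)} ≤ a(n)` whenever `a(n) > 0`; and `θ(n) ≤ 2^{b(n)+1}` whenever `n ≥ 1` and
`0 ≤ a(n) ≤ 1` (`θ = stepRatio a q`, `θ ≤ 2q`). [cite: Regev2009, Lemma 3.14 (proof), Theorem 3.1 (proof)] -/
theorem exists_poly_param_window {a : ℕ → ℚ} {q : ℕ → ℕ} (ha : PolyTimeComputable unaryEncodeNat encodeRat a)
    (hq : PolyTimeComputable unaryEncodeNat encodeNat q) :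
    ∃ b : Polynomial ℕ, ∀ n,
      (a n : ℝ) * q n ≤ (2 : ℝ) ^ b.eval n ∧
      (0 < a n → (2⁻¹ : ℝ) ^ b.eval n ≤ (a n : ℝ)) ∧
      (0 < n → 0 ≤ a n → a n ≤ 1 → ((stepRatio a q n : ℚ) : ℝ) ≤ (2 : ℝ) ^ (b.eval n + 1)) := by
  obtain ⟨sa, hsa⟩ := exists_poly_abs_window ha
  obtain ⟨sq, hsq⟩ := exists_poly_lt_two_pow hq
  refine ⟨sa + sq, fun n => ⟨?_, fun h0 => ?_, fun hn h0 h1 => ?_⟩⟩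
  · have hq' : (q n : ℝ) ≤ (2 : ℝ) ^ sq.eval n := by exact_mod_cast (hsq n).le
    calc (a n : ℝ) * q n ≤ |(a n : ℝ)| * q n := by gcongr; exact le_abs_self _
      _ ≤ (2 : ℝ) ^ sa.eval n * (2 : ℝ) ^ sq.eval n :=
          mul_le_mul (hsa n).1 hq' (Nat.cast_nonneg _) (by positivity)
      _ = (2 : ℝ) ^ (sa + sq).eval n := by rw [eval_add, pow_add]
  · have h := (hsa n).2 h0.ne'
    rw [abs_of_pos (by exact_mod_cast h0 : (0 : ℝ) < a n)] at h
    exact le_trans (pow_le_pow_of_le_one (by norm_num) (by norm_num) (by rw [eval_add]; omega)) h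
  · have hq' : (q n : ℝ) ≤ (2 : ℝ) ^ sq.eval n := by exact_mod_cast (hsq n).le
    calc ((stepRatio a q n : ℚ) : ℝ) ≤ 2 * q n := stepRatio_le_two_mul a q hn h0 h1
      _ ≤ 2 * (2 : ℝ) ^ sq.eval n := by gcongr
      _ ≤ (2 : ℝ) ^ ((sa + sq).eval n + 1) := by
          rw [pow_succ, mul_comm, eval_add]
          exact mul_le_mul_of_nonneg_right (pow_le_pow_right₀ one_le_two (by omega)) (by norm_num)

end SamplerRegs

end Regev2009

end Literature.Computability.Cryptography

end
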